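import Mathlib
import Summits.KontsevichZagierPeriods.Zeta5Search.ClusterValuationPairs
import HarnessLib

/-!
# ζ(5) search — the UNIVERSAL FIRST-DIGIT LEMMA (statement layer) and the class data of the record cell A

Cell `pub-zeta5` (HONEST FRAMING: systematic search; no irrationality claim unless certified), ideation seat gen-2,
generation 9 (REPORT-gen2-g9 §1–§2).  STATEMENTS ONLY (`@[conjecture] def … : Prop`), all PROVED ON PAPER in REPORT-gen2-g9 §1
modulo Theorem B (`LeadingDigit`) — the `ĝ`-identities and the residue identities unconditionally — and exact-checked on
≈ 150,000 pole classes of random polytope vectors (`g9/udigit.py`, 0 failures).  Nothing here bears on irrationality: these are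
`p`-adic digits of the partial-fraction data of the Brown–Zudilin rational function `R_b`.

Notation (tree, `ClusterValuation.lean`): positions `q ∈ [0,b₀]`, `netExp`, residue class `classSet b p x`, LEVEL `ℓ_q = q / p`,
class exponent `E_x = classExp`, `ρ_{q,σ} = classRho b p q σ`, the unit `ĝ_q = gHat b p q`, class pieces `𝒦_x = classK`, `V_x = classV`.
New here: the pole set `classPoles`, and the three TYPE INVARIANTS
* `cHat b p x = ĉ_x := Σ_{poles q} (ℓ_q² ρ_{q,1} + 2ℓ_q ρ_{q,2})`      (first digit of `𝒦_x`, needs `E_x ≤ −3`),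
* `vHat b p x = v̂_x := Σ_{poles q} Σ_{σ=1}^{n_q} (−1)^σ ρ_{q,σ} H^{(σ)}_{ℓ_q}`   (first digit of `V_x`),
* `wHat b p x = ŵ_x := Σ_{poles q, n_q ≥ 3} ρ_{q,3}`      (first digit of the `W`-row `W_x = Σ_{q∈x} c_{2,q}`; any `E_x`),
with the digit statements `KDigit`, `VDigit`, `WDigit`, the residue identities `RhoResidueIdentities` (`Σρ₁ = 0`, `Σ(ρ₂+ℓρ₁) = 0`,
`Σ(ρ₃+2ℓρ₂+ℓ²ρ₁) = [E=−3]`), the `ĝ`-identities `GHatClassCongr` (class-constant mod `p`), `GHatConj` (conjugation sign, exact),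
`GHatShift` (shift rule, exact), and the reversal identity `CHatReversal` (`ĉ_{x̄} = (−1)^{E+1} ĉ_x`), from which the parity vanishing
of even-`E` palindromic conjugate pairs and THEOREM LB♯♯ (`LemmaDBonus`, G8 file) follow on paper (REPORT-gen2-g9 §1.6–1.7).
Finally `RecordCellClassData`: the arithmetic class-structure lemma of the record cell `14n < p < 15n` (REPORT §2.2, PROVED for all
`n ≥ 2` on paper; `decide`d here at `(n,p) = (2,29)`), i.e. the hypotheses of `LemmaDBonus` at `b = bRec n`, `j = 7`, `m = −4`, and the
two-line reduction `recordCellA_of_bonus` of census g11's `RecordCellA` to "bonus `+1` over `casLB = −5`".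
-/

open Finset

namespace Summit.KontsevichZagierPeriods.Zeta5Search.ClusterValuation

open Summit.KontsevichZagierPeriods.Zeta5Search.WedgeDictionary (pfData dOf)
open Summit.KontsevichZagierPeriods.Zeta5Search.CasoratianValuation (InPolytope shift casoratian)
open Literature.NumberTheory.Transcendental.BallRivoal (harm)

/-! ## §1 Type invariants of a residue class -/

/-- The poles of the class of `x`: class points of negative net exponent. -/
def classPoles (b : ℕ → ℤ) (p x : ℕ) : Finset ℕ := (classSet b p x).filter fun q => netExp b q < 0

/-- `ĉ_x := Σ_{poles q ∈ x} (ℓ_q² ρ_{q,1} + 2 ℓ_q ρ_{q,2})`, `ℓ_q = q / p` the level (`ρ_{q,2} = 0` for a simple pole since then the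
truncated subtraction `n_q − 2` would make `classRho b p q 2 = coeff 0 = ρ_{q,1}`, so the `ρ_{q,2}` term is cut off explicitly for simple poles;
likewise in `wHat` and `RhoResidueIdentities`). -/
noncomputable def cHat (b : ℕ → ℤ) (p x : ℕ) : ℚ :=
  ∑ q ∈ classPoles b p x,
    ((((q / p : ℕ) : ℚ)) ^ 2 * classRho b p q 1
      + if netExp b q ≤ -2 then 2 * ((q / p : ℕ) : ℚ) * classRho b p q 2 else 0)

/-- `v̂_x := Σ_{poles q ∈ x} Σ_{σ=1}^{n_q} (−1)^σ ρ_{q,σ} H^{(σ)}_{ℓ_q}` (`H^{(σ)}_ℓ = harm σ ℓ = Σ_{m=1}^{ℓ} m^{−σ}`). -/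
noncomputable def vHat (b : ℕ → ℤ) (p x : ℕ) : ℚ :=
  ∑ q ∈ classPoles b p x, ∑ σ ∈ Icc 1 (-netExp b q).toNat, (-1 : ℚ) ^ σ * classRho b p q σ * harm σ (q / p)

/-- `ŵ_x := Σ_{poles q ∈ x of order ≥ 3} ρ_{q,3}`. -/
noncomputable def wHat (b : ℕ → ℤ) (p x : ℕ) : ℚ :=
  ∑ q ∈ classPoles b p x, if netExp b q ≤ -3 then classRho b p q 3 else 0

/-! ## §2 The universal first-digit lemma (REPORT-gen2-g9 §1.2–1.3b; PROVED on paper modulo `LeadingDigit`) -/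

/-- **U-V (first digit of `V_x`)**: `V_x = (−p)^{E_x}(ĝ_q v̂_x + O(p))` for any pole `q` of the class
(split `H_q^{(σ)} = p^{−σ}H^{(σ)}_{ℓ_q} + (p-integral)`, Theorem B, `ĝ` class-constant mod `p`).  Exact check 118,807 classes. -/
@[conjecture] def VDigit : Prop :=
  ∀ (b : ℕ → ℤ) (p x q : ℕ), InPolytope b → p.Prime → 5 ≤ p → (b 0 + 2 : ℤ) < (p : ℤ) ^ 2 → x < p →
    q ∈ classSet b p x → netExp b q < 0 →
      classV b p x - (-(p : ℚ)) ^ classExp b p x * gHat b p q * vHat b p x ≠ 0 →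
        classExp b p x + 1 ≤ padicValRat p (classV b p x - (-(p : ℚ)) ^ classExp b p x * gHat b p q * vHat b p x)

/-- **U-K (first digit of `𝒦_x`, `E_x ≤ −3`)**: `𝒦_x = (−p)^{E_x+1} p² (ĝ_q ĉ_x + O(p))`
(only `o ∈ {0,1}` reach the order `E+3`: `g₀(k) = p²φ_k²`, `g₁(k) ≡ 2pφ_k (mod p²)`, `φ_k = (k^p−k)/p`, `φ_{k+ℓp} ≡ φ_k − ℓ`; the Fermat
quotient `φ` cancels by the residue identities `Σρ₁ = 0`, `Σ(ρ₂+ℓρ₁) = 0`, which need `E_x ≤ −3` — the statement is FALSE for `E_x = −2`).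
Exact check 104,951 classes. -/
@[conjecture] def KDigit : Prop :=
  ∀ (b : ℕ → ℤ) (p x q : ℕ), InPolytope b → p.Prime → 5 ≤ p → (b 0 + 2 : ℤ) < (p : ℤ) ^ 2 → x < p →
    q ∈ classSet b p x → netExp b q < 0 → classExp b p x ≤ -3 →
      classK b p x - (-(p : ℚ)) ^ (classExp b p x + 1) * (p : ℚ) ^ 2 * gHat b p q * cHat b p x ≠ 0 →
        classExp b p x + 4 ≤
          padicValRat p (classK b p x - (-(p : ℚ)) ^ (classExp b p x + 1) * (p : ℚ) ^ 2 * gHat b p q * cHat b p x)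

/-- **U-W (first digit of the `W`-row `W_x := Σ_{q ∈ x} c_{2,q}`, any `E_x`)**: `W_x = (−p)^{E_x+3}(ĝ_q ŵ_x + O(p))` (Theorem B at `σ = 3`).
This is the row system of P1 g5's Lean proof of `RecordCellA` (no Fermat quotients).  Exact check 29,384 classes. -/
@[conjecture] def WDigit : Prop :=
  ∀ (b : ℕ → ℤ) (p x q : ℕ), InPolytope b → p.Prime → 5 ≤ p → (b 0 + 2 : ℤ) < (p : ℤ) ^ 2 → x < p →
    q ∈ classSet b p x → netExp b q < 0 →
      (∑ s ∈ classSet b p x, pfData b 2 s) - (-(p : ℚ)) ^ (classExp b p x + 3) * gHat b p q * wHat b p x ≠ 0 →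
        classExp b p x + 4 ≤
          padicValRat p ((∑ s ∈ classSet b p x, pfData b 2 s) - (-(p : ℚ)) ^ (classExp b p x + 3) * gHat b p q * wHat b p x)

/-- **Residue identities** of the class function `Φ_x(η) = ∏_{s∈x}(η−ℓ_s)^{e_s}·[(η−ℓ_c)]` (degree `E_x`, monic): the sums of the residues of
`Φ_x`, `ηΦ_x`, `η²Φ_x` over the finite poles are `0`, `0`, `[E_x = −3]` when `E_x ≤ −2`, `≤ −3`, `≤ −3` respectively (residue at `∞`).
Elementary; exact check 27,619 / 25,875 / 25,875 classes. -/
@[conjecture] def RhoResidueIdentities : Prop :=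
  ∀ (b : ℕ → ℤ) (p x : ℕ), InPolytope b → p.Prime → 5 ≤ p → (b 0 + 2 : ℤ) < (p : ℤ) ^ 2 → x < p →
    (classExp b p x ≤ -2 → ∑ q ∈ classPoles b p x, classRho b p q 1 = 0) ∧
    (classExp b p x ≤ -3 →
      ∑ q ∈ classPoles b p x, ((if netExp b q ≤ -2 then classRho b p q 2 else 0) + ((q / p : ℕ) : ℚ) * classRho b p q 1) = 0) ∧
    (classExp b p x ≤ -3 →
      ∑ q ∈ classPoles b p x, ((if netExp b q ≤ -3 then classRho b p q 3 else 0)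
          + 2 * ((q / p : ℕ) : ℚ) * (if netExp b q ≤ -2 then classRho b p q 2 else 0)
          + (((q / p : ℕ) : ℚ)) ^ 2 * classRho b p q 1)
        = if classExp b p x = -3 then 1 else 0)

/-! ## §3 The units `ĝ` and the reversal identity (REPORT-gen2-g9 §1.4–1.5; PROVED on paper, unconditionally) -/

/-- **G1**: `ĝ` is a `p`-unit and is constant modulo `p` on a residue class. Exact check 118,807 classes. -/
@[conjecture] def GHatClassCongr : Prop :=
  ∀ (b : ℕ → ℤ) (p x q q' : ℕ), InPolytope b → p.Prime → 5 ≤ p → x < p →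
    q ∈ classSet b p x → q' ∈ classSet b p x →
      padicValRat p (gHat b p q) = 0 ∧ (gHat b p q ≠ gHat b p q' → 1 ≤ padicValRat p (gHat b p q - gHat b p q'))

/-- **G2 (conjugation sign, EXACT)**: for a class not containing the centre, `ĝ_{b₀−q} = (−1)^{E_x+1} ĝ_q`
(`s ↦ b₀−s` preserves `netExp`; the total degree of `R_b` is odd).  Exact check 110,364 classes. -/
@[conjecture] def GHatConj : Prop :=
  ∀ (b : ℕ → ℤ) (p x q : ℕ), InPolytope b → p.Prime → 5 ≤ p → x < p → ¬ CentreIn b p x →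
    q ∈ classSet b p x → gHat b p ((b 0).toNat - q) = (-1 : ℚ) ^ (classExp b p x + 1) * gHat b p q

/-- **G3 (shift rule, EXACT)**: if neither moved point `b_j`, `b₀−b_j` of the shift `b ↦ b+e_j` lies in the class of `q`, then
`ĝ_q(b+e_j) = ĝ_q(b)·(b_j − q)(b₀ − b_j − q)` (block `j` shrinks from `[b_j, b₀−b_j]` to `[b_j+1, b₀−b_j−1]`, raising `netExp` by one at the
two (distinct, as `2b_j+2 ≤ b₀`) moved points and nowhere else).  Exact check 7,513 classes. -/
@[conjecture] def GHatShift : Prop :=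
  ∀ (b : ℕ → ℤ) (p x q j : ℕ), InPolytope b → 1 ≤ j → j ≤ 7 → InPolytope (shift b j) → p.Prime → 5 ≤ p → x < p →
    q ∈ classSet b p x → (b j).toNat ∉ classSet b p x → (b 0 - b j).toNat ∉ classSet b p x →
      gHat (shift b j) p q = gHat b p q * ((b j : ℚ) - q) * (((b 0 - b j : ℤ) : ℚ) - q)

/-- **R (reversal identity)**: for a class with `E_x ≤ −3` not containing the centre, `ĉ_{x̄} = (−1)^{E_x+1} ĉ_x` for the conjugate class
`x̄ = conjClass b p x` (type reversed: `ρ^{x̄}_{L−ℓ,σ} = (−1)^{E+σ}ρ_{ℓ,σ}`, then the residue identities; `ĉ` is invariant under a common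
shift of the levels).  With `GHatConj` and `KDigit`/`VDigit` this gives the pair aggregates `k_P = 2ḡ_xĉ_x`, `v_P = ḡ_x(v̂_x + (−1)^{E+1}v̂_x̄)`
and the PARITY VANISHING `k_P = v_P = 0` for even-`E` palindromic pairs (REPORT §1.6).  Exact check 104,951 classes. -/
@[conjecture] def CHatReversal : Prop :=
  ∀ (b : ℕ → ℤ) (p x : ℕ), InPolytope b → p.Prime → 5 ≤ p → (b 0 + 2 : ℤ) < (p : ℤ) ^ 2 → x < p →
    classExp b p x ≤ -3 → ¬ CentreIn b p x →
      cHat b p (conjClass b p x) = (-1 : ℚ) ^ (classExp b p x + 1) * cHat b p x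

/-! ## §4 The record cell A: class data (REPORT-gen2-g9 §2.2, PROVED for all `n ≥ 2`) and the reduction of `RecordCellA` -/

/-- **CLASS-STRUCTURE LEMMA of the record cell** `14n < p < 15n`, `n ≥ 2`, `b = bRec n = n·(41;17,…,11)` (REPORT-gen2-g9 §2.2, the case
`t = 11` of the family lemma, PROVED on paper; machine-checked for every `n ≤ 60` and every odd `p` in the cell): `casLB = −5`; the multipole
classes have `E ∈ {−4,−3}`, `−4` attained, and `E = −4` exactly for the BARE two-point classes `{x, x+p}` of exponent vectors
`(−1,−3)`, `(−2,−2)`, `(−3,−1)` not containing the centre; every single-pole class has `ν ≥ −3`; no `E = −4` class contains the moved points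
`11n`, `30n` of the direction `e₇`.  These are the hypotheses of `LemmaDBonus` (G8 file) at `m = −4` (the `(−2,−2)` classes are its
`droppedPair`s, the others are pairwise `sameType`). -/
@[conjecture] def RecordCellClassData : Prop :=
  ∀ n p : ℕ, 2 ≤ n → p.Prime → 14 * n < p → p < 15 * n →
    casLB (bRec n) p = -5 ∧
    (∃ x ∈ multipoleClasses (bRec n) p, classExp (bRec n) p x = -4) ∧
    (∀ x ∈ multipoleClasses (bRec n) p, -4 ≤ classExp (bRec n) p x) ∧
    (∀ y, y < p → classPoleCount (bRec n) p y = 1 → -3 ≤ classNu (bRec n) p y) ∧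
    (∀ x ∈ multipoleClasses (bRec n) p, classExp (bRec n) p x = -4 →
      ¬ CentreIn (bRec n) p x ∧ classSet (bRec n) p x = {x, x + p} ∧ 11 * n ≠ x ∧ 30 * n ≠ x + p ∧
      ((netExp (bRec n) x = -1 ∧ netExp (bRec n) (x + p) = -3) ∨
       (netExp (bRec n) x = -2 ∧ netExp (bRec n) (x + p) = -2) ∨
       (netExp (bRec n) x = -3 ∧ netExp (bRec n) (x + p) = -1)))

/-- `casLB = −5` at the smallest instance `(n,p) = (2,29)` of the record cell (`b = (82; 34,32,30,28,26,24,22)`), by `decide`. -/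
example : casLB (bRec 2) 29 = -5 := by
  set_option maxRecDepth 20000 in decide

/-- The minimal classes at `(n,p) = (2,29)`, exactly as REPORT-gen2-g9 §2.2 predicts: the pair `x = 25 = 27n−p` (type `(−1,−3)`) /
`x̄ = 28 = 14n` (type `(−3,−1)`), and the dropped `(−2,−2)` pair `{26, 27}` (`26 ↦ (82−26−29) = 27`; `(41n−p)/2` is not an integer here, so
no self-conjugate multipole class). -/
example : classExp (bRec 2) 29 25 = -4 ∧ netExp (bRec 2) 25 = -1 ∧ netExp (bRec 2) 54 = -3 ∧
    classExp (bRec 2) 29 28 = -4 ∧ netExp (bRec 2) 28 = -3 ∧ netExp (bRec 2) 57 = -1 ∧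
    classExp (bRec 2) 29 26 = -4 ∧ netExp (bRec 2) 26 = -2 ∧ netExp (bRec 2) 55 = -2 ∧
    classExp (bRec 2) 29 27 = -4 ∧ netExp (bRec 2) 27 = -2 ∧ netExp (bRec 2) 56 = -2 := by
  set_option maxRecDepth 20000 in decide

/-- **The Lemma-D bonus on the record cell** (the conclusion of `LemmaDBonus` (G8 file) at `b = bRec n`, `j = 7`, `14n < p < 15n`;
follows from `LemmaDBonus`, `RecordCellClassData` and `recordCellSide_holds`; PROVED on paper, REPORT-gen2-g9 §2). -/
@[conjecture] def RecordCellBonus : Prop :=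
  ∀ n p : ℕ, 2 ≤ n → p.Prime → 14 * n < p → p < 15 * n → casoratian (bRec n) 7 ≠ 0 →
    casLB (bRec n) p + 1 ≤ padicValRat p (casoratian (bRec n) 7)

/-- Reduction statement: census g11's `RecordCellA` (`−4 ≤ v_p(Cas₇(bRec n))` on the cell) from the bonus and `casLB = −5`. -/
def recordCellA_of_bonus_stmt : Prop :=
  RecordCellBonus → (∀ n p : ℕ, 2 ≤ n → p.Prime → 14 * n < p → p < 15 * n → casLB (bRec n) p = -5) →
    ∀ n p : ℕ, 2 ≤ n → p.Prime → 14 * n < p → p < 15 * n → casoratian (bRec n) 7 ≠ 0 →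
      (-4 : ℤ) ≤ padicValRat p (casoratian (bRec n) 7)

/-- PROOF of `recordCellA_of_bonus_stmt` (two lines). -/
theorem recordCellA_of_bonus_holds : recordCellA_of_bonus_stmt := by
  intro hBonus hLB n p hn hp h1 h2 hc
  have h := hBonus n p hn hp h1 h2 hc
  rw [hLB n p hn hp h1 h2] at h
  linarith

/-- The side conditions of `LemmaDBonus` on the record cell: polytope for `b` and `b + e₇`, `5 ≤ p ≤ b₀`, `p ≤ d = 25n`, window `b₀ + 2 < p²`. -/
def recordCellSide_stmt : Prop :=
  ∀ n p : ℕ, 2 ≤ n → 14 * n < p → p < 15 * n →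
    InPolytope (bRec n) ∧ InPolytope (shift (bRec n) 7) ∧ 5 ≤ p ∧ (p : ℤ) ≤ bRec n 0 ∧ (p : ℤ) ≤ dOf (bRec n) ∧
      (bRec n 0 + 2 : ℤ) < (p : ℤ) ^ 2

/-- PROOF of `recordCellSide_stmt` (`inPolytope_bRec`, `inPolytope_shift_bRec`, linear arithmetic). -/
theorem recordCellSide_holds : recordCellSide_stmt := by
  intro n p hn h1 h2
  refine ⟨inPolytope_bRec n, inPolytope_shift_bRec n 7 (by omega) (by norm_num) (by norm_num), by omega, ?_, ?_, ?_⟩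
  · simp [bRec]; omega
  · simp [dOf, bRec, Finset.sum_range_succ]; nlinarith
  · simp [bRec]
    have h28 : (28 : ℤ) < p := by exact_mod_cast (show 28 < p by omega)
    have hpn : (14 * n : ℤ) < p := by exact_mod_cast h1
    nlinarith

end Summit.KontsevichZagierPeriods.Zeta5Search.ClusterValuation
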